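import Summits.SmoothPoincare4.SmoothPoincare4.Theorems.EntropyRungNoncompactShrinkerGapLiWangAllScalesAux
import Summits.SmoothPoincare4.SmoothPoincare4.Theorems.EntropyRungNoncompactShrinkerGapHeatShrinkerCutoff
import Summits.SmoothPoincare4.SmoothPoincare4.Theorems.EntropyRungNoncompactShrinkerGapHeatFlowExistence
import Summits.SmoothPoincare4.SmoothPoincare4.Theorems.EntropyRungNoncompactShrinkerGapHeatGradientDecay
import Summits.SmoothPoincare4.SmoothPoincare4.Theorems.EntropyRungNoncompactShrinkerGapHeatEnergyEstimate
import Summits.SmoothPoincare4.SmoothPoincare4.Theorems.EntropyRungNoncompactShrinkerGapHeatMassConservation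
import Summits.SmoothPoincare4.SmoothPoincare4.Theorems.EntropyRungNoncompactShrinkerGapCarrilloNiClauses
import Literature.Geometry.Riemannian.ShrinkerEntropyAllScalesProofs
import HarnessLib

/-!
# Li–Wang 2020, Thm. 1.1 — the logarithmic Sobolev constant of a complete gradient shrinker at all
# scales: discharge of the named fact `LiWang2020_shrinkerLSI_allScales`
# (crux `EntropyRung.NoncompactShrinkerGap`, stmt-SmoothPoincare4-10868, line `collapsed-ends-usc`,
# stub `helper_liWangAllScales`)

The Literature named fact `Literature.Geometry.Riemannian.LiWang2020_shrinkerLSI_allScales`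
(`ShrinkerEntropyAllScales.lean`; Y. Li, B. Wang, *Heat kernel on Ricci shrinkers*, Calc. Var. PDE 59
(2020), Thm. 1.1 = Prop. 5.9: on a complete connected normalised gradient shrinker
`log ((4π)^{-n/2} ∫ e^{-f}) ≤ 𝒲(g, ψ, τ)` for every `τ > 0` and every admissible `ψ`) is REDUCED in the
tree (`LiWang2020_shrinkerLSI_allScales_of_heatFlow`, `ShrinkerEntropyAllScalesProofs.lean`) to the
existence, on every such shrinker and for every smooth positive datum `ρ₀` constant outside a compact
set, of the weighted heat flow `∂ₜu = Δu − g⁻¹(df, du)` jointly smooth on `M × [0, ∞)` with the linear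
a-priori package (values in `[a, b]`, `|Lu|` bounded, `|∇u(t)|² ≤ e^{-t} C`, conserved `∫ u e^{-f}`).
This file supplies that flow from the heat-flow toolkit of the line (leads c8/c9, namespace
`…Theorems.NoncompactShrinkerGapHeat`) and closes the fact:

* `heatFlow_unique` — uniqueness of the energy-class flow on `[0, T]` (weak maximum principle
  `helper_twoSidedBound` for the difference of two solutions);
* `shrinker_heatFlow` — the global flow with its package: the shrinker cut-offs `helper_shrinkerCutoff`
  (`|Δη_k|, |⟨∇f, ∇η_k⟩| ≤ C`), the coercivity `¼|∇f|² − ½Δf + 1 + n/4 ≥ 1` (`Δf = n/2 − R`, `R ≥ 0`),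
  the flows `u_T` on `[0, T]` of `helper_heatFlowExistence`, glued along `T = k + 1` by
  `heatFlow_unique`; bounds `helper_twoSidedBound`, `helper_energyEstimate` + `helper_gradientDecay`
  (`Ric + Hess f = g/2`, `K = ½`), `helper_massConservation`, and the bounded generator
  `heatFlow_weightedLaplacian_abs_le` (`EntropyRungNoncompactShrinkerGapLiWangAllScalesAux.lean`);
* `helper_liWangAllScales` — the registered stub, `= LiWang2020_shrinkerLSI_allScales`, by
  `LiWang2020_shrinkerLSI_allScales_of_heatFlow shrinker_heatFlow`;
* `liWang2020_shrinkerLSI_allScales_holds` — the discharge alias of the named fact.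

## References

* [LiWang2020] Y. Li, B. Wang, Calc. Var. PDE 59 (2020) no. 194 (arXiv:1901.05691): Thm. 1.1 (p. 3),
  Prop. 5.9, Lemmas 5.10–5.11 (p. 20); §§2–3 (heat kernel of the shrinker).
* [Grigoryan2009] A. Grigor'yan, *Heat Kernel and Analysis on Manifolds* (2009), §11.4, §12.1.
* [BakryGentilLedoux2014] D. Bakry, I. Gentil, M. Ledoux (2014), Thm. 3.2.3/3.2.4 (pp. 143–146).
* [CarrilloNi2009] J. A. Carrillo, L. Ni, Comm. Anal. Geom. 17 (2009), §§3–4 (the case `τ = 1`).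
-/

noncomputable section

set_option linter.dupNamespace false

open scoped Manifold ContDiff ENNReal NNReal Topology
open MeasureTheory Set Filter
open Literature.Geometry.Lorentzian Literature.Geometry.Riemannian

namespace Summit.SmoothPoincare4.SmoothPoincare4.Theorems.NoncompactShrinkerGapLiWang

open NoncompactShrinkerGapHeat NoncompactShrinkerGapHeat.CutoffToolkit NoncompactShrinkerGapCarrilloNiClauses

section Weighted

variable {n : ℕ} {M : Type*} [TopologicalSpace M] [T2Space M] [SecondCountableTopology M]
  [ChartedSpace (EuclideanSpace ℝ (Fin n)) M] [IsManifold (𝓡 n) ∞ M] [T3Space M]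
  [MeasurableSpace M] [BorelSpace M]
  {g : PseudoRiemannianMetric (𝓡 n) ∞ (EuclideanSpace ℝ (Fin n)) (TangentSpace (𝓡 n) : M → Type _)}
  [g.HasLeviCivita]

/-- **Uniqueness of the weighted heat flow in the energy class `𝕃²(e^{-V}dV_g ⊗ dt)`**: two
solutions of `∂ₛρ = Lρ` on `[0, T]`, smooth on `M × Oᵢ` (`Oᵢ ⊇ [0, T]` open), with the same
datum and `(ρᵢ − c)² e^{-V}` integrable on the strip, coincide on `[0, T] × M` — the weak maximum
principle (`helper_twoSidedBound` with `c₁ = C₁ = 0`) applied to the solution `ρ₁ − ρ₂`.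
[cite: Grigoryan2009, §11.4 and §12.1] -/
theorem heatFlow_unique (hg : g.IsRiemannian) {V : M → ℝ} (hV : ContMDiff (𝓡 n) 𝓘(ℝ, ℝ) ∞ V)
    (hfin : Integrable (fun x ↦ Real.exp (-V x)) g.riemVolume)
    {η : ℕ → M → ℝ} {C : ℝ} (hηs : ∀ k, ContMDiff (𝓡 n) 𝓘(ℝ, ℝ) ∞ (η k))
    (hηc : ∀ k, HasCompactSupport (η k)) (hη01 : ∀ k x, 0 ≤ η k x ∧ η k x ≤ 1)
    (hηmono : ∀ k x, η k x ≤ η (k + 1) x) (hη1 : ∀ x, ∀ᶠ k in atTop, ∀ᶠ y in 𝓝 x, η k y = 1)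
    (hηL : ∀ k x, |g.dalembertian (η k) x - g.innerDual x (mvfderiv (𝓡 n) V x).toLinearMap
      (mvfderiv (𝓡 n) (η k) x).toLinearMap| ≤ C)
    {T : ℝ} (hT : 0 < T) {O₁ O₂ : Set ℝ} {ρ₁ ρ₂ : ℝ → M → ℝ} (hO₁ : IsOpen O₁) (hO₂ : IsOpen O₂)
    (hTO₁ : Icc 0 T ⊆ O₁) (hTO₂ : Icc 0 T ⊆ O₂)
    (hρ₁ : ContMDiffOn ((𝓡 n).prod 𝓘(ℝ, ℝ)) 𝓘(ℝ, ℝ) ∞ (fun p : M × ℝ ↦ ρ₁ p.2 p.1) (univ ×ˢ O₁))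
    (hρ₂ : ContMDiffOn ((𝓡 n).prod 𝓘(ℝ, ℝ)) 𝓘(ℝ, ℝ) ∞ (fun p : M × ℝ ↦ ρ₂ p.2 p.1) (univ ×ˢ O₂))
    (heq₁ : ∀ s ∈ Icc 0 T, ∀ x, deriv (fun r ↦ ρ₁ r x) s = g.dalembertian (ρ₁ s) x
      - g.innerDual x (mvfderiv (𝓡 n) V x).toLinearMap (mvfderiv (𝓡 n) (ρ₁ s) x).toLinearMap)
    (heq₂ : ∀ s ∈ Icc 0 T, ∀ x, deriv (fun r ↦ ρ₂ r x) s = g.dalembertian (ρ₂ s) x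
      - g.innerDual x (mvfderiv (𝓡 n) V x).toLinearMap (mvfderiv (𝓡 n) (ρ₂ s) x).toLinearMap)
    (h0 : ∀ x, ρ₁ 0 x = ρ₂ 0 x) {c : ℝ}
    (hint₁ : Integrable (fun p : M × ℝ ↦ (ρ₁ p.2 p.1 - c) ^ 2 * Real.exp (-V p.1))
      ((g.riemVolume.prod (volume : Measure ℝ)).restrict (univ ×ˢ Ioo 0 T)))
    (hint₂ : Integrable (fun p : M × ℝ ↦ (ρ₂ p.2 p.1 - c) ^ 2 * Real.exp (-V p.1))
      ((g.riemVolume.prod (volume : Measure ℝ)).restrict (univ ×ˢ Ioo 0 T))) :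
    ∀ s ∈ Icc 0 T, ∀ x, ρ₁ s x = ρ₂ s x := by
  intro s hs x
  have h2 : (2 : ℕ∞ω) ≤ (∞ : ℕ∞ω) := WithTop.coe_le_coe.mpr le_top
  set O : Set ℝ := O₁ ∩ O₂ with hOdef
  have hO : IsOpen O := hO₁.inter hO₂
  have hTO : Icc 0 T ⊆ O := subset_inter hTO₁ hTO₂
  have hexpc : Continuous fun y ↦ Real.exp (-V y) := Real.continuous_exp.comp hV.continuous.neg
  set z : ℝ → M → ℝ := fun r y ↦ ρ₁ r y + (-1) * ρ₂ r y with hzdef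
  have hzs : ContMDiffOn ((𝓡 n).prod 𝓘(ℝ, ℝ)) 𝓘(ℝ, ℝ) ∞ (fun p : M × ℝ ↦ z p.2 p.1) (univ ×ˢ O) :=
    (hρ₁.mono (Set.prod_mono le_rfl inter_subset_left)).add
      (contMDiffOn_const.mul (hρ₂.mono (Set.prod_mono le_rfl inter_subset_right)))
  have heqz : ∀ r ∈ Icc 0 T, ∀ y, deriv (fun r' ↦ z r' y) r = g.dalembertian (z r) y -
      g.innerDual y (mvfderiv (𝓡 n) V y).toLinearMap (mvfderiv (𝓡 n) (z r) y).toLinearMap := by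
    intro r hr y
    have hd : HasDerivAt (fun r' ↦ z r' y)
        (deriv (fun r' ↦ ρ₁ r' y) r + (-1) * deriv (fun r' ↦ ρ₂ r' y) r) r :=
      (hasDerivAt_time hO₁ hρ₁ y (hTO₁ hr)).add ((hasDerivAt_time hO₂ hρ₂ y (hTO₂ hr)).const_mul (-1))
    rw [hd.deriv, heq₁ r hr y, heq₂ r hr y, show z r = fun y' ↦ ρ₁ r y' + (-1) * ρ₂ r y' from rfl,
      weightedLaplacian_add_const_mul
        (((contMDiff_slice_of_contMDiffOn hρ₁ (hTO₁ hr)).of_le h2).contMDiffAt)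
        (((contMDiff_slice_of_contMDiffOn hρ₂ (hTO₂ hr)).of_le h2).contMDiffAt)]
  have hz0 : ∀ y, (0 : ℝ) ≤ z 0 y ∧ z 0 y ≤ 0 := fun y ↦ by
    simp only [hzdef, h0 y]; constructor <;> linarith
  have hbound : Integrable (fun p : M × ℝ ↦ 2 * ((ρ₁ p.2 p.1 - c) ^ 2 * Real.exp (-V p.1) +
      (ρ₂ p.2 p.1 - c) ^ 2 * Real.exp (-V p.1)))
      ((g.riemVolume.prod (volume : Measure ℝ)).restrict (univ ×ˢ Ioo 0 T)) :=
    (hint₁.add hint₂).const_mul 2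
  have hint : Integrable (fun p : M × ℝ ↦ (z p.2 p.1 - 0) ^ 2 * Real.exp (-V p.1))
      ((g.riemVolume.prod (volume : Measure ℝ)).restrict (univ ×ˢ Ioo 0 T)) := by
    refine hbound.mono' ?_ (ae_of_all _ fun p ↦ ?_)
    · have hcont : ContinuousOn (fun p : M × ℝ ↦ (z p.2 p.1 - 0) ^ 2 * Real.exp (-V p.1))
          (univ ×ˢ O) :=
        ((hzs.continuousOn.sub continuousOn_const).pow 2).mul
          (hexpc.comp continuous_fst).continuousOn
      exact (hcont.mono (Set.prod_mono le_rfl (Ioo_subset_Icc_self.trans hTO))).aestronglyMeasurable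
        (MeasurableSet.univ.prod measurableSet_Ioo)
    · have hex := Real.exp_pos (-V p.1)
      rw [Real.norm_eq_abs, abs_of_nonneg (mul_nonneg (sq_nonneg _) hex.le)]
      simp only [hzdef]
      have : (ρ₁ p.2 p.1 + (-1) * ρ₂ p.2 p.1 - 0) ^ 2 ≤
          2 * ((ρ₁ p.2 p.1 - c) ^ 2 + (ρ₂ p.2 p.1 - c) ^ 2) := by
        nlinarith [sq_nonneg (ρ₁ p.2 p.1 + ρ₂ p.2 p.1 - 2 * c)]
      nlinarith
  have h := helper_twoSidedBound n M g V hg hV hfin η C hηs hηc hη01 hηmono hη1 hηL T O z hT hO hTO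
    hzs heqz 0 0 0 le_rfl le_rfl hz0 hint s hs x
  have hz : z s x = 0 := le_antisymm h.2 h.1
  simp only [hzdef] at hz
  linarith

end Weighted

section Shrinker

variable {n : ℕ} {M : Type} [TopologicalSpace M] [T2Space M] [SecondCountableTopology M]
  [ChartedSpace (EuclideanSpace ℝ (Fin n)) M] [IsManifold (𝓡 n) ∞ M] [ConnectedSpace M] [T3Space M]
  [MeasurableSpace M] [BorelSpace M]
  {g : PseudoRiemannianMetric (𝓡 n) ∞ (EuclideanSpace ℝ (Fin n)) (TangentSpace (𝓡 n) : M → Type _)}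
  [g.HasLeviCivita] {f : M → ℝ}

/-- **The global weighted heat flow of a complete gradient shrinker with its a-priori package**
(the hypothesis `hflow` of `LiWang2020.log_le_wEntropy_of_heatFlow`): on a complete connected
normalised gradient shrinker `(M, g, f)` and for a smooth datum `ρ₀` constant outside a compact
set with values in `[a, b]`, `a > 0`, there is `u` jointly smooth on `M × [0, ∞)` with `u(0) = ρ₀`,
`∂ₜu = Δu − g⁻¹(df, du)`, `a ≤ u ≤ b`, `|Lu| ≤ C_L`, `|∇u(t)|² ≤ e^{-t} C_Γ` and
`∫ u(t) e^{-f} = ∫ ρ₀ e^{-f}`. The flows `u_T` on `[0, T]` of `helper_heatFlowExistence` (shrinker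
cut-offs `helper_shrinkerCutoff`, coercivity `¼|∇f|² − ½Δf + 1 + n/4 ≥ 1` from `Δf = n/2 − R`,
`R ≥ 0`) agree on overlaps (`heatFlow_unique`) and glue to `u`; the package is
`helper_twoSidedBound`, `helper_energyEstimate` + `helper_gradientDecay` (`K = ½`),
`helper_massConservation` and `heatFlow_weightedLaplacian_abs_le`.
[cite: LiWang2020, §§2–3 (arXiv:1901.05691)] [cite: Grigoryan2009, §11.4 and §12.1]
[cite: BakryGentilLedoux2014, Thm. 3.2.3/3.2.4 (pp. 143–146)] -/
theorem shrinker_heatFlow (hg : g.IsRiemannian)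
    (hc : ∀ (x : M) (r : NNReal), IsCompact {y : M | g.riemEDist x y ≤ r})
    (hf : ContMDiff (𝓡 n) 𝓘(ℝ, ℝ) ∞ f)
    (hsol : ∀ (x : M) (X Y : TangentSpace (𝓡 n) x),
      g.ricci x X Y + g.hessian f x X Y = (1 / 2 : ℝ) * g.val x X Y)
    (hnorm : ∀ x : M, g.scalarCurvature x + g.gradSq f x = f x)
    (ρ₀ : M → ℝ) (hρ₀ : ContMDiff (𝓡 n) 𝓘(ℝ, ℝ) ∞ ρ₀)
    (hK : ∃ K₀ : Set M, IsCompact K₀ ∧ ∃ c₀ : ℝ, ∀ x, x ∉ K₀ → ρ₀ x = c₀)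
    (a b : ℝ) (ha : 0 < a) (hab : ∀ x, a ≤ ρ₀ x ∧ ρ₀ x ≤ b) :
    ∃ u : ℝ → M → ℝ,
      ContMDiffOn ((𝓡 n).prod 𝓘(ℝ, ℝ)) 𝓘(ℝ, ℝ) ∞ (fun p : M × ℝ ↦ u p.2 p.1) (univ ×ˢ Ici 0) ∧
      u 0 = ρ₀ ∧
      (∀ t ∈ Ici (0 : ℝ), ∀ x, derivWithin (fun s ↦ u s x) (Ici 0) t =
        g.dalembertian (u t) x
          - g.innerDual x (mvfderiv (𝓡 n) f x : TangentSpace (𝓡 n) x →ₗ[ℝ] ℝ)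
              (mvfderiv (𝓡 n) (u t) x : TangentSpace (𝓡 n) x →ₗ[ℝ] ℝ)) ∧
      (∀ t ∈ Ici (0 : ℝ), ∀ x, a ≤ u t x ∧ u t x ≤ b) ∧
      (∃ CL : ℝ, ∀ t ∈ Ici (0 : ℝ), ∀ x, |g.dalembertian (u t) x
        - g.innerDual x (mvfderiv (𝓡 n) f x : TangentSpace (𝓡 n) x →ₗ[ℝ] ℝ)
            (mvfderiv (𝓡 n) (u t) x : TangentSpace (𝓡 n) x →ₗ[ℝ] ℝ)| ≤ CL) ∧
      (∃ CΓ : ℝ, ∀ t ∈ Ici (0 : ℝ), ∀ x, g.gradSq (u t) x ≤ Real.exp (-t) * CΓ) ∧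
      (∀ t ∈ Ici (0 : ℝ), ∫ x, u t x * Real.exp (-f x) ∂g.riemVolume =
        ∫ x, ρ₀ x * Real.exp (-f x) ∂g.riemVolume) := by
  classical
  haveI := CarrilloNi2009_shrinkerLSI.isFiniteMeasureOnCompacts_riemVolume hg
  have h2 : (2 : ℕ∞ω) ≤ (∞ : ℕ∞ω) := WithTop.coe_le_coe.mpr le_top
  have hc' : ∀ (x : M) (r : NNReal), IsCompact {y : M | g.edist hg x y ≤ r} := fun x r ↦ by
    simpa only [PseudoRiemannianMetric.riemEDist_eq hg] using hc x r
  /- the shrinker toolkit: `R ≥ 0`, `M` nonempty, `e^{-f} ∈ L¹`, `CD(½, ∞)`, cut-offs, coercivity -/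
  obtain ⟨hR0, hne, -⟩ := scalarCurvature_nonneg_and_isCompact_sublevel g f hg hc' hf hsol hnorm
  haveI := hne
  have hZi : Integrable (fun x ↦ Real.exp (-f x)) g.riemVolume :=
    carrilloNi_integrable_exp_neg g f hg hc' hf hsol hnorm
  have hRic : ∀ (x : M) (X : TangentSpace (𝓡 n) x),
      (1 / 2 : ℝ) * g.val x X X ≤ g.ricci x X X + g.hessian f x X X := fun x X ↦ (hsol x X X).ge
  obtain ⟨η, C, hηs, hηc, hη01, hηmono, hη1, -, hηΔ, hηf⟩ :=
    helper_shrinkerCutoff n M g f hg hc' hf hsol hnorm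
  have hη1' : ∀ x, ∀ᶠ k in atTop, ∀ᶠ y in 𝓝 x, η k y = 1 := fun x ↦ by
    filter_upwards [tendsto_natCast_atTop_atTop.eventually (eventually_gt_atTop (f x))] with k hk
    exact hη1 k x (by linarith)
  have hηL : ∀ k x, |g.dalembertian (η k) x - g.innerDual x (mvfderiv (𝓡 n) f x).toLinearMap
      (mvfderiv (𝓡 n) (η k) x).toLinearMap| ≤ C + C := fun k x ↦
    (abs_sub _ _).trans (add_le_add (hηΔ k x) (hηf k x))
  have hlam : ∀ x, 1 ≤ g.gradSq f x / 4 - g.dalembertian f x / 2 + (1 + n / 4) := fun x ↦ by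
    have h1 := CarrilloNi2009_shrinkerLSI.scalarCurvature_add_dalembertian hsol x
    have h3 := g.gradSq_nonneg hg f x
    linarith [hR0 x]
  /- the datum: `ρ₀ = c + ψ₀`, `c ∈ [a, b]`, `ψ₀ ∈ C_c^∞`; bounds `b − a`, `G₀`, `C_L` -/
  obtain ⟨K₀, hK₀, c₀, hc₀⟩ := hK
  obtain ⟨c, hac, hcb, hcK⟩ : ∃ c, a ≤ c ∧ c ≤ b ∧ ∀ x, x ∉ K₀ → ρ₀ x = c := by
    by_cases h : ∃ x, x ∉ K₀
    · obtain ⟨x, hx⟩ := h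
      exact ⟨c₀, hc₀ x hx ▸ (hab x).1, hc₀ x hx ▸ (hab x).2, hc₀⟩
    · push Not at h
      exact ⟨a, le_rfl, (hab hne.some).1.trans (hab hne.some).2, fun x hx ↦ absurd (h x) hx⟩
  set ψ₀ : M → ℝ := fun x ↦ ρ₀ x - c with hψ₀def
  have hψ : ContMDiff (𝓡 n) 𝓘(ℝ, ℝ) ∞ ψ₀ := hρ₀.sub contMDiff_const
  have hψ0 : ∀ x, x ∉ K₀ → ψ₀ x = 0 := fun x hx ↦ by simp [hψ₀def, hcK x hx]
  have hψc : HasCompactSupport ψ₀ := HasCompactSupport.intro hK₀ hψ0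
  have hρ₀eq : ∀ x, c + ψ₀ x = ρ₀ x := fun x ↦ by simp only [hψ₀def]; ring
  have hB : ∀ x, |ρ₀ x - c| ≤ b - a := fun x ↦
    abs_le.2 ⟨by linarith [(hab x).1], by linarith [(hab x).2]⟩
  obtain ⟨G₀, hG₀⟩ := exists_forall_abs_le_of_eventuallyConst (contMDiff_gradSq g hρ₀).continuous
    ⟨K₀, hK₀, 0, fun x hx ↦
      g.gradSq_eq_zero_of_mvfderiv_eq_zero (mvfderiv_eq_zero_of_eventuallyConst hK₀ hcK hx)⟩
  have hG₀' : ∀ x, g.gradSq ρ₀ x ≤ G₀ := fun x ↦ (le_abs_self _).trans (hG₀ x)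
  obtain ⟨hLc, hLcs⟩ := continuous_hasCompactSupport_weightedLaplacian (g := g) (V := f) hψ hψc hf
  obtain ⟨CL, hCL⟩ := hLc.bounded_above_of_compact_support hLcs
  have hCL' : ∀ x, |g.dalembertian ρ₀ x - g.innerDual x (mvfderiv (𝓡 n) f x).toLinearMap
      (mvfderiv (𝓡 n) ρ₀ x).toLinearMap| ≤ CL := fun x ↦ by
    have hρ₀fun : ρ₀ = fun y ↦ 1 * ψ₀ y + c := funext fun y ↦ by simp only [hψ₀def]; ring
    rw [hρ₀fun, weightedLaplacian_affine ((hψ.of_le h2).contMDiffAt) 1 c, one_mul,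
      ← Real.norm_eq_abs]
    exact hCL x
  /- the flow with horizon `T` and its a-priori package -/
  have hpack : ∀ T : ℝ, 0 < T → ∃ (O : Set ℝ) (ρ : ℝ → M → ℝ), IsOpen O ∧ Icc 0 T ⊆ O ∧
      ContMDiffOn ((𝓡 n).prod 𝓘(ℝ, ℝ)) 𝓘(ℝ, ℝ) ∞ (fun p : M × ℝ ↦ ρ p.2 p.1) (univ ×ˢ O) ∧
      ρ 0 = ρ₀ ∧
      (∀ s ∈ Icc 0 T, ∀ x, deriv (fun r ↦ ρ r x) s = g.dalembertian (ρ s) x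
        - g.innerDual x (mvfderiv (𝓡 n) f x).toLinearMap (mvfderiv (𝓡 n) (ρ s) x).toLinearMap) ∧
      Integrable (fun p : M × ℝ ↦ (ρ p.2 p.1 - c) ^ 2 * Real.exp (-f p.1))
        ((g.riemVolume.prod (volume : Measure ℝ)).restrict (univ ×ˢ Ioo 0 T)) ∧
      (∀ s ∈ Icc 0 T, ∀ x, a ≤ ρ s x ∧ ρ s x ≤ b) ∧
      (∀ s ∈ Icc 0 T, ∀ x, g.gradSq (ρ s) x ≤ Real.exp (-s) * G₀) ∧
      (∀ s ∈ Icc 0 T, ∫ x, ρ s x * Real.exp (-f x) ∂g.riemVolume =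
        ∫ x, ρ₀ x * Real.exp (-f x) ∂g.riemVolume) ∧
      (∀ s ∈ Ico 0 T, ∀ x, |g.dalembertian (ρ s) x
        - g.innerDual x (mvfderiv (𝓡 n) f x).toLinearMap (mvfderiv (𝓡 n) (ρ s) x).toLinearMap| ≤ CL) := by
    intro T hT
    obtain ⟨O, ρ, hO, hTO, hρ, hρ0, heq, hint⟩ := helper_heatFlowExistence n M g f (1 + n / 4) hg hf
      hlam η C hηs hηc hη01 hηmono hη1' hηΔ c ψ₀ hψ hψc T hT
    have hρ0' : ρ 0 = ρ₀ := funext fun x ↦ (hρ0 x).trans (hρ₀eq x)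
    have hbd : ∀ s ∈ Icc 0 T, ∀ x, a ≤ ρ s x ∧ ρ s x ≤ b :=
      helper_twoSidedBound n M g f hg hf hZi η (C + C) hηs hηc hη01 hηmono hη1' hηL T O ρ hT hO hTO
        hρ heq c a b hac hcb (fun x ↦ by rw [hρ0']; exact hab x) hint
    have hint0 : Integrable (fun x ↦ (ρ 0 x - c) ^ 2 * Real.exp (-f x)) g.riemVolume := by
      rw [hρ0']
      refine Continuous.integrable_of_hasCompactSupport
        ((hψ.continuous.pow 2).mul (Real.continuous_exp.comp hf.continuous.neg)) ?_
      exact HasCompactSupport.intro hK₀ fun x hx ↦ by simp [hcK x hx]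
    obtain ⟨hgradInt, -⟩ := helper_energyEstimate n M g f hg hf η (C + C) hηs hηc hη01 hηmono hη1'
      hηL T O ρ hT hO hTO hρ heq c hint hint0
    have hgd : ∀ s ∈ Icc 0 T, ∀ x, g.gradSq (ρ s) x ≤ Real.exp (-s) * G₀ := fun s hs x ↦ by
      have h := helper_gradientDecay n M g f (1 / 2) hg hf hRic η (C + C) hηs hηc hη01 hηmono hη1'
        hηL T O ρ hT hO hTO hρ heq hgradInt G₀ (fun x ↦ by rw [hρ0']; exact hG₀' x) s hs x
      rwa [show -2 * (1 / 2 : ℝ) * s = -s by ring] at h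
    have habs : ∀ s ∈ Icc 0 T, ∀ x, |ρ s x| ≤ b := fun s hs x ↦ by
      rw [abs_of_nonneg (ha.le.trans (hbd s hs x).1)]; exact (hbd s hs x).2
    have hmass : ∀ s ∈ Icc 0 T, ∫ x, ρ s x * Real.exp (-f x) ∂g.riemVolume =
        ∫ x, ρ₀ x * Real.exp (-f x) ∂g.riemVolume := fun s hs ↦ by
      rw [helper_massConservation n M g f hg hf hZi η (C + C) hηs hηc hη01 hηmono hη1' hηL T O ρ hT
        hO hTO hρ heq b habs s hs, hρ0']
    have hLb := heatFlow_weightedLaplacian_abs_le hg hf hZi hηs hηc hη01 hηmono hη1' hηL hT hO hTO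
      hρ heq (c := c) (B := b - a) (CL := CL) (fun x ↦ by rw [hρ0']; exact hB x)
      (fun x ↦ by rw [hρ0']; exact hCL' x) hint
    exact ⟨O, ρ, hO, hTO, hρ, hρ0', heq, hint, hbd, hgd, hmass, hLb⟩
  choose O ρ hO hTO hρ hρ0 heq hint hbd hgd hmass hLb using hpack
  /- the flows with integer horizons `k + 1` agree on overlaps and glue to `u` -/
  have hTk : ∀ k : ℕ, (0 : ℝ) < k + 1 := fun k ↦ by positivity
  set R : ℕ → ℝ → M → ℝ := fun k ↦ ρ (k + 1) (hTk k) with hRdef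
  have hcons : ∀ (j k : ℕ), ∀ s ∈ Icc (0 : ℝ) (min (j : ℝ) k + 1), ∀ x, R j s x = R k s x := by
    intro j k
    have hmin : (0 : ℝ) < min (j : ℝ) k + 1 := by positivity
    have hj : Icc (0 : ℝ) (min (j : ℝ) k + 1) ⊆ Icc 0 ((j : ℝ) + 1) :=
      Icc_subset_Icc_right (by linarith [min_le_left (j : ℝ) k])
    have hk : Icc (0 : ℝ) (min (j : ℝ) k + 1) ⊆ Icc 0 ((k : ℝ) + 1) :=
      Icc_subset_Icc_right (by linarith [min_le_right (j : ℝ) k])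
    refine heatFlow_unique hg hf hZi hηs hηc hη01 hηmono hη1' hηL hmin (hO _ _) (hO _ _)
      (hj.trans (hTO _ _)) (hk.trans (hTO _ _)) (hρ _ _) (hρ _ _)
      (fun s hs x ↦ heq _ _ s (hj hs) x) (fun s hs x ↦ heq _ _ s (hk hs) x)
      (fun x ↦ by simp only [hRdef, hρ0]) (c := c) ?_ ?_
    · exact (hint _ _).mono_measure (Measure.restrict_mono (Set.prod_mono le_rfl
        (Ioo_subset_Ioo_right (by linarith [min_le_left (j : ℝ) k]))) le_rfl)
    · exact (hint _ _).mono_measure (Measure.restrict_mono (Set.prod_mono le_rfl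
        (Ioo_subset_Ioo_right (by linarith [min_le_right (j : ℝ) k]))) le_rfl)
  set u : ℝ → M → ℝ := fun t ↦ R ⌈t⌉₊ t with hudef
  have hu : ∀ (k : ℕ) (t : ℝ), t ∈ Icc (0 : ℝ) (k + 1) → u t = R k t := by
    intro k t ht
    have h1 : t ≤ min (⌈t⌉₊ : ℝ) k + 1 := by
      rcases le_total (⌈t⌉₊ : ℝ) k with h | h
      · rw [min_eq_left h]; linarith [Nat.le_ceil t]
      · rw [min_eq_right h]; exact ht.2
    exact funext fun x ↦ hcons ⌈t⌉₊ k t ⟨ht.1, h1⟩ x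
  have hceil : ∀ t : ℝ, t < (⌈t⌉₊ : ℝ) + 1 := fun t ↦ by linarith [Nat.le_ceil t]
  refine ⟨u, ?_, ?_, ?_, ?_, ⟨CL, ?_⟩, ⟨G₀, ?_⟩, ?_⟩
  · -- joint smoothness on `M × [0, ∞)`
    rintro ⟨x, t⟩ ⟨-, ht⟩
    have ht' : (0 : ℝ) ≤ t := ht
    set k : ℕ := ⌈t⌉₊ with hkdef
    have hlt : t < (k : ℝ) + 1 := hceil t
    have hat : ContMDiffAt ((𝓡 n).prod 𝓘(ℝ, ℝ)) 𝓘(ℝ, ℝ) ∞ (fun q : M × ℝ ↦ R k q.2 q.1) (x, t) :=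
      (hρ _ _).contMDiffAt ((isOpen_univ.prod (hO _ _)).mem_nhds ⟨mem_univ _, hTO _ _ ⟨ht', hlt.le⟩⟩)
    refine hat.contMDiffWithinAt.congr_of_eventuallyEq ?_ (by simp only [hu k t ⟨ht', hlt.le⟩])
    have hN : (univ : Set M) ×ˢ Iio ((k : ℝ) + 1) ∈ 𝓝 (x, t) :=
      (isOpen_univ.prod isOpen_Iio).mem_nhds ⟨mem_univ _, hlt⟩
    filter_upwards [mem_nhdsWithin_of_mem_nhds hN, self_mem_nhdsWithin] with q hq hq'
    have hq2 : (0 : ℝ) ≤ q.2 := hq'.2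
    simp only [hu k q.2 ⟨hq2, le_of_lt hq.2⟩]
  · -- initial datum
    exact hρ0 _ _
  · -- the equation, with the one-sided derivative within `[0, ∞)`
    intro t ht x
    have ht' : (0 : ℝ) ≤ t := ht
    set k : ℕ := ⌈t⌉₊ with hkdef
    have hlt : t < (k : ℝ) + 1 := hceil t
    have htk : t ∈ Icc (0 : ℝ) (k + 1) := ⟨ht', hlt.le⟩
    have hd : HasDerivAt (fun s ↦ R k s x) (deriv (fun s ↦ R k s x) t) t :=
      hasDerivAt_time (hO _ _) (hρ _ _) x (hTO _ _ htk)
    have hdw : HasDerivWithinAt (fun s ↦ u s x) (deriv (fun s ↦ R k s x) t) (Ici 0) t := by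
      refine hd.hasDerivWithinAt.congr_of_eventuallyEq ?_ (by rw [hu k t htk])
      filter_upwards [mem_nhdsWithin_of_mem_nhds (Iio_mem_nhds hlt), self_mem_nhdsWithin]
        with s hs hs'
      have hs0 : (0 : ℝ) ≤ s := hs'
      rw [hu k s ⟨hs0, le_of_lt hs⟩]
    rw [hdw.derivWithin (uniqueDiffOn_Ici 0 t ht), heq _ _ t htk x, hu k t htk]
  · -- two-sided bounds
    intro t ht x
    have ht' : (0 : ℝ) ≤ t := ht
    have htk : t ∈ Icc (0 : ℝ) (⌈t⌉₊ + 1) := ⟨ht', (hceil t).le⟩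
    rw [hu _ t htk]
    exact hbd _ _ t htk x
  · -- `|Lu| ≤ C_L`
    intro t ht x
    have ht' : (0 : ℝ) ≤ t := ht
    have htk : t ∈ Icc (0 : ℝ) (⌈t⌉₊ + 1) := ⟨ht', (hceil t).le⟩
    rw [hu _ t htk]
    exact hLb _ _ t ⟨ht', hceil t⟩ x
  · -- gradient decay
    intro t ht x
    have ht' : (0 : ℝ) ≤ t := ht
    have htk : t ∈ Icc (0 : ℝ) (⌈t⌉₊ + 1) := ⟨ht', (hceil t).le⟩
    rw [hu _ t htk]
    exact hgd _ _ t htk x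
  · -- conservation of mass
    intro t ht
    have ht' : (0 : ℝ) ≤ t := ht
    have htk : t ∈ Icc (0 : ℝ) (⌈t⌉₊ + 1) := ⟨ht', (hceil t).le⟩
    rw [hu _ t htk]
    exact hmass _ _ t htk

end Shrinker

/-- **Stub `helper_liWangAllScales` = the named fact `LiWang2020_shrinkerLSI_allScales`**
(Li–Wang 2020, Thm. 1.1 / Prop. 5.9: the optimal logarithmic Sobolev constant of a complete
gradient shrinker is `log Θ` at ALL scales), discharged by the reduction
`LiWang2020_shrinkerLSI_allScales_of_heatFlow` fed with the global energy-class weighted heat flow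
of the shrinker (`shrinker_heatFlow`). [cite: LiWang2020, Thm. 1.1 and Prop. 5.9] -/
theorem helper_liWangAllScales : Literature.Geometry.Riemannian.LiWang2020_shrinkerLSI_allScales :=
  LiWang2020_shrinkerLSI_allScales_of_heatFlow
    fun _n _M _ _ _ _ _ _ _ _ _ _g _ _f hg hc hf hsol hnorm ρ₀ hρ₀ hK a b ha hab ↦
      shrinker_heatFlow hg hc hf hsol hnorm ρ₀ hρ₀ hK a b ha hab

/-- **Li–Wang 2020, Thm. 1.1 holds** (discharge alias of the named fact
`LiWang2020_shrinkerLSI_allScales`). [cite: LiWang2020, Thm. 1.1 and Prop. 5.9] -/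
theorem liWang2020_shrinkerLSI_allScales_holds :
    Literature.Geometry.Riemannian.LiWang2020_shrinkerLSI_allScales :=
  helper_liWangAllScales

end Summit.SmoothPoincare4.SmoothPoincare4.Theorems.NoncompactShrinkerGapLiWang

end
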